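import Summits.Ventures.Crystal3D.Theorems.StickyWulffConstantPolycrystalWulffBoundFibreChimera
import Summits.Ventures.Crystal3D.Theorems.StickyWulffConstantPolycrystalWulffBoundChimeraRuns

/-!
# Chimera Brunn–Minkowski with RUNS IN THE ABSCISSA inside every height slice (engine, part 1, for the
# charged ZONE textures of `PolycrystalWulffBound`, line `PolyDensity`, crux `stmt-Ventures-19482`)

Route `StickyWulffConstant` of the venture `Summits/Ventures/Crystal3D`, second prover lane (poly-p2,
gen 9).  The charge-free zone engine `chimera3_fibre_brunnMinkowski` (`…FibreChimera`) needs the bodies'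
fibres to dominate one reference in length; the n-first runs engine `chimera3_runs_pow` (`…ChimeraRuns`)
cuts the HEIGHT axis into runs.  For zone textures whose walls are transversal to the fibre direction
(the `⟨110⟩` zone: walls containing the horizontal bond `u`, fibres along `u`, abscissa along the
horizontal `⟨112⟩` direction `w`; seat memos P-TWIN-g8 §1 «m-first» and P-TWIN-g9 §4(a)) the runs must
be cut along the ABSCISSA inside every height slice, each run carrying its own body and its own
abscissa WINDOW (a quantile window of that body's slice), and the outer height level stays
Prékopa–Leindler:
* `chimera2_runs_volume_rpow_mul_le` — planar runs: `Σ_i |A ∩ {p₁ ∈ I_i}|^{1−s}|K_i ∩ {p₁ ∈ J_i}|^s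
  ≤ Σ_i |C ∩ {p₁ ∈ Z_i}|` for windows `Z_i ⊇ (1−s)I_i + sJ_i`;
* `chimera3_sliceRuns_volume_rpow_mul_le` — **the engine, multiplicative form**: if for every pair of
  heights `(t, u)` the slice `A_t` is cut into abscissa runs `I_i` with mass fractions `θ_i`
  (`Σ θ_i = 1`), bodies `K_i` whose slices at height `u` carry windows `J_i` of mass `≥ θ_i·|W₀_u|`,
  pairwise DISJOINT windows `Z_i ⊇ (1−s)I_i + sJ_i`, and `C ∋ (1−s)a + s w` for `a ∈ A_t` over `I_i`,
  `w ∈ K_i` at height `u` over `J_i`, then `|A|^{1−s}·|W₀|^s ≤ |C|`.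
In the intended application the windows are consecutive quantile windows of the abscissa marginals of
the slices of `W` and `R_m W`; their mismatch is `≤ (2/√6)|⟪e_k, w⟫|` uniformly in the height
(`cruxWulffBody_twin_slab_cdf_le`, `…TwinSectionShiftSlabHolds`), and disjointness of the `Z_i` is bought
by TRIMMING `A` below each wall (as in `rung_inclinedLamellar_of_quantiles`), which is where the wall
charge `≤ 1/√6 < ½` is paid.
* `chimera3_sliceRuns_pow`, `chimera3_sliceRuns_brunnMinkowski` — homogeneous and root forms
  (`(a+b)³ ≤ |C|`, `|A|^{1/3} + |W₀|^{1/3} ≤ |C|^{1/3}`) by scaling, as in `…FibreChimera`.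
WHAT THIS IS NOT: the trimming and the zone rung (part 2: runs = abscissa intervals between the wall
traces of each height slice of the TRIMMED set, windows = consecutive quantile windows of the slices'
abscissa marginals, disjointness from the slab shift `cruxWulffBody_twin_slab_cdf_le`); the crux is not
claimed. -/

noncomputable section

namespace Summit.Ventures.Crystal3D.Theorems.Chimera

open MeasureTheory Set
open scoped ENNReal Pointwise

/-! ### Planar runs -/

/-- Abscissa strips `{p | p.1 ∈ I}` of the plane are measurable for measurable `I`. -/
theorem measurableSet_abscissaStrip {I : Set ℝ} (hI : MeasurableSet I) :
    MeasurableSet {p : ℝ × ℝ | p.1 ∈ I} :=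
  hI.preimage measurable_fst

/-- **Planar chimera Brunn–Minkowski with abscissa runs.**  For runs `I_i`, bodies `K_i` with abscissa
windows `J_i`, and windows `Z_i ⊇ (1−s)I_i + sJ_i`: if `C ∋ (1−s)p + s q` whenever `p ∈ A`, `p₁ ∈ I_i`,
`q ∈ K_i`, `q₁ ∈ J_i`, then `Σ_i |A ∩ {I_i}|^{1−s}·|K_i ∩ {J_i}|^s ≤ Σ_i |C ∩ {Z_i}|`. -/
theorem chimera2_runs_volume_rpow_mul_le {s : ℝ} (hs0 : 0 < s) (hs1 : s < 1) {N : ℕ}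
    {A C : Set (ℝ × ℝ)} (I J Z : Fin N → Set ℝ) (K : Fin N → Set (ℝ × ℝ))
    (hA : MeasurableSet A) (hC : MeasurableSet C) (hK : ∀ i, MeasurableSet (K i))
    (hI : ∀ i, MeasurableSet (I i)) (hJ : ∀ i, MeasurableSet (J i)) (hZ : ∀ i, MeasurableSet (Z i))
    (hIJZ : ∀ i, (1 - s) • I i + s • J i ⊆ Z i)
    (hsub : ∀ i, ∀ p ∈ A, p.1 ∈ I i → ∀ q ∈ K i, q.1 ∈ J i → (1 - s) • p + s • q ∈ C) :
    ∑ i, volume (A ∩ {p : ℝ × ℝ | p.1 ∈ I i}) ^ (1 - s) *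
        volume (K i ∩ {p : ℝ × ℝ | p.1 ∈ J i}) ^ s ≤
      ∑ i, volume (C ∩ {p : ℝ × ℝ | p.1 ∈ Z i}) := by
  refine Finset.sum_le_sum fun i _ => ?_
  refine chimera2_fibre_volume_rpow_mul_le hs0 hs1 (fun _ => K i ∩ {p : ℝ × ℝ | p.1 ∈ J i})
    (hA.inter (measurableSet_abscissaStrip (hI i))) (hC.inter (measurableSet_abscissaStrip (hZ i)))
    ((hK i).inter (measurableSet_abscissaStrip (hJ i)))
    (fun _ => (hK i).inter (measurableSet_abscissaStrip (hJ i))) (fun _ _ => le_rfl) ?_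
  rintro p ⟨hp, hpI⟩ q ⟨hq, hqJ⟩
  refine ⟨hsub i p hp hpI q hq hqJ, ?_⟩
  show ((1 - s) • p + s • q).1 ∈ Z i
  rw [Prod.fst_add, Prod.smul_fst, Prod.smul_fst]
  exact hIJZ i (Set.add_mem_add (Set.smul_mem_smul_set hpI) (Set.smul_mem_smul_set hqJ))

/-! ### The engine: Prékopa–Leindler over the height, runs in the abscissa of every slice -/

/-- **Chimera Brunn–Minkowski with abscissa runs in every height slice, multiplicative form**
(`Fin 3 → ℝ`; height = coordinate `2`, abscissa = coordinate `0`).  Suppose that for every pair of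
heights `(t, u)` there are runs `I_i`, bodies `K_i`, abscissa windows `J_i`, pairwise disjoint windows
`Z_i ⊇ (1−s)I_i + sJ_i` and mass fractions `θ_i` with `Σ θ_i = 1`,
`θ_i·|A_t| ≤ |A_t ∩ {I_i}|`, `θ_i·|(W₀)_u| ≤ |(K_i)_u ∩ {J_i}|`, and
`C ∋ (1−s)a + s w` for `a ∈ A` at height `t` over `I_i` and `w ∈ K_i` at height `u` over `J_i`.
Then `|A|^{1−s}·|W₀|^s ≤ |C|`. -/
theorem chimera3_sliceRuns_volume_rpow_mul_le {s : ℝ} (hs0 : 0 < s) (hs1 : s < 1)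
    {A C W₀ : Set (Fin 3 → ℝ)} (hA : MeasurableSet A) (hC : MeasurableSet C) (hW₀ : MeasurableSet W₀)
    (hruns : ∀ t u : ℝ, ∃ (N : ℕ) (I J Z : Fin N → Set ℝ) (K : Fin N → Set (Fin 3 → ℝ))
        (θ : Fin N → ℝ≥0∞),
      (∀ i, MeasurableSet (I i)) ∧ (∀ i, MeasurableSet (J i)) ∧ (∀ i, MeasurableSet (Z i)) ∧
      (∀ i, MeasurableSet (K i)) ∧ (∀ i, (1 - s) • I i + s • J i ⊆ Z i) ∧
      (∀ i j, i ≠ j → Disjoint (Z i) (Z j)) ∧ (∑ i, θ i = 1) ∧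
      (∀ i, θ i * volume {p : ℝ × ℝ | (![p.1, p.2, t] : Fin 3 → ℝ) ∈ A} ≤
        volume {p : ℝ × ℝ | (![p.1, p.2, t] : Fin 3 → ℝ) ∈ A ∧ p.1 ∈ I i}) ∧
      (∀ i, θ i * volume {p : ℝ × ℝ | (![p.1, p.2, u] : Fin 3 → ℝ) ∈ W₀} ≤
        volume {p : ℝ × ℝ | (![p.1, p.2, u] : Fin 3 → ℝ) ∈ K i ∧ p.1 ∈ J i}) ∧
      (∀ i, ∀ a ∈ A, a 2 = t → a 0 ∈ I i → ∀ w ∈ K i, w 2 = u → w 0 ∈ J i →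
        (1 - s) • a + s • w ∈ C)) :
    volume A ^ (1 - s) * volume W₀ ^ s ≤ volume C := by
  set φ : ℝ → ℝ≥0∞ := fun t => volume {p : ℝ × ℝ | (![p.1, p.2, t] : Fin 3 → ℝ) ∈ A} with hφ
  set ψ : ℝ → ℝ≥0∞ := fun u => volume {p : ℝ × ℝ | (![p.1, p.2, u] : Fin 3 → ℝ) ∈ W₀} with hψ
  set h : ℝ → ℝ≥0∞ := fun z => volume {p : ℝ × ℝ | (![p.1, p.2, z] : Fin 3 → ℝ) ∈ C} with hh
  have key : ∀ t u, φ t ^ (1 - s) * ψ u ^ s ≤ h ((1 - s) • t + s • u) := by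
    intro t u
    obtain ⟨N, I, J, Z, K, θ, hI, hJ, hZ, hK, hIJZ, hZdisj, hθ1, hθA, hθW, hsub⟩ := hruns t u
    -- slices
    set At : Set (ℝ × ℝ) := {p : ℝ × ℝ | (![p.1, p.2, t] : Fin 3 → ℝ) ∈ A} with hAt
    set Ku : Fin N → Set (ℝ × ℝ) := fun i => {p : ℝ × ℝ | (![p.1, p.2, u] : Fin 3 → ℝ) ∈ K i} with hKu
    set Cz : Set (ℝ × ℝ) := {p : ℝ × ℝ | (![p.1, p.2, (1 - s) • t + s • u] : Fin 3 → ℝ) ∈ C} with hCz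
    have hAtm : MeasurableSet At := measurableSet_slice3 hA t
    have hKum : ∀ i, MeasurableSet (Ku i) := fun i => measurableSet_slice3 (hK i) u
    have hCzm : MeasurableSet Cz := measurableSet_slice3 hC _
    -- each run contributes `θ_i · φ^{1-s} ψ^s`
    have hθtop : ∀ i, θ i ≠ ⊤ := fun i => by
      have : θ i ≤ 1 := by
        rw [← hθ1]; exact Finset.single_le_sum (fun j _ => zero_le) (Finset.mem_univ i)
      exact ne_top_of_le_ne_top ENNReal.one_ne_top this
    have hrun : ∀ i, θ i * (φ t ^ (1 - s) * ψ u ^ s) ≤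
        volume (At ∩ {p : ℝ × ℝ | p.1 ∈ I i}) ^ (1 - s) * volume (Ku i ∩ {p : ℝ × ℝ | p.1 ∈ J i}) ^ s := by
      intro i
      have hsplit : θ i = θ i ^ (1 - s) * θ i ^ s := by
        rw [← ENNReal.rpow_add_of_nonneg _ _ (by linarith) hs0.le]
        norm_num
      have h1 : θ i ^ (1 - s) * φ t ^ (1 - s) ≤ volume (At ∩ {p : ℝ × ℝ | p.1 ∈ I i}) ^ (1 - s) := by
        rw [← ENNReal.mul_rpow_of_nonneg _ _ (by linarith)]
        exact ENNReal.rpow_le_rpow (by simpa [hAt, Set.setOf_and] using hθA i) (by linarith)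
      have h2 : θ i ^ s * ψ u ^ s ≤ volume (Ku i ∩ {p : ℝ × ℝ | p.1 ∈ J i}) ^ s := by
        rw [← ENNReal.mul_rpow_of_nonneg _ _ hs0.le]
        exact ENNReal.rpow_le_rpow (by simpa [hKu, Set.setOf_and] using hθW i) hs0.le
      calc θ i * (φ t ^ (1 - s) * ψ u ^ s)
          = (θ i ^ (1 - s) * φ t ^ (1 - s)) * (θ i ^ s * ψ u ^ s) := by
            conv_lhs => rw [hsplit]
            ring
        _ ≤ _ := mul_le_mul' h1 h2
    -- planar runs in the slices
    have hplanar := chimera2_runs_volume_rpow_mul_le hs0 hs1 I J Z Ku hAtm hCzm hKum hI hJ hZ hIJZ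
      (by
        intro i p hp hpI q hq hqJ
        have hp' : (![p.1, p.2, t] : Fin 3 → ℝ) ∈ A := hp
        have hq' : (![q.1, q.2, u] : Fin 3 → ℝ) ∈ K i := hq
        have h1 := hsub i _ hp' (by simp) (by simpa using hpI) _ hq' (by simp) (by simpa using hqJ)
        have e : (1 - s) • (![p.1, p.2, t] : Fin 3 → ℝ) + s • (![q.1, q.2, u] : Fin 3 → ℝ) =
            ![((1 - s) • p + s • q).1, ((1 - s) • p + s • q).2, (1 - s) • t + s • u] := by
          ext j; fin_cases j <;> simp [smul_eq_mul]
        rw [e] at h1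
        exact h1)
    -- the windows are disjoint: the right-hand side is at most `h(ζ)`
    have hdisjU : ∑ i, volume (Cz ∩ {p : ℝ × ℝ | p.1 ∈ Z i}) ≤ h ((1 - s) • t + s • u) := by
      rw [← measure_biUnion_finset (fun i _ j _ hij => ?_) (fun i _ => hCzm.inter (measurableSet_abscissaStrip (hZ i)))]
      · exact measure_mono (iUnion₂_subset fun i _ => inter_subset_left)
      · show Disjoint (Cz ∩ {p : ℝ × ℝ | p.1 ∈ Z i}) (Cz ∩ {p : ℝ × ℝ | p.1 ∈ Z j})
        rw [Set.disjoint_left]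
        rintro p ⟨-, hpi⟩ ⟨-, hpj⟩
        exact Set.disjoint_left.1 (hZdisj i j hij) hpi hpj
    calc φ t ^ (1 - s) * ψ u ^ s = ∑ i, θ i * (φ t ^ (1 - s) * ψ u ^ s) := by
          rw [← Finset.sum_mul, hθ1, one_mul]
      _ ≤ ∑ i, volume (At ∩ {p : ℝ × ℝ | p.1 ∈ I i}) ^ (1 - s) *
            volume (Ku i ∩ {p : ℝ × ℝ | p.1 ∈ J i}) ^ s := Finset.sum_le_sum fun i _ => hrun i
      _ ≤ ∑ i, volume (Cz ∩ {p : ℝ × ℝ | p.1 ∈ Z i}) := hplanar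
      _ ≤ h ((1 - s) • t + s • u) := hdisjU
  have pl := Literature.Analysis.Convexity.prekopaLeindler_real hs0 hs1 (measurable_volume_slice3 hA)
    (measurable_volume_slice3 hW₀) (measurable_volume_slice3 hC) key
  rw [volume_eq_lintegral_slice3 A hA, volume_eq_lintegral_slice3 W₀ hW₀, volume_eq_lintegral_slice3 C hC]
  exact pl

/-! ### Scaling of slices and strips -/

/-- Dilating an abscissa strip: `r • (P ∩ {p₁ ∈ I}) = (r • P) ∩ {p₁ ∈ r • I}` (`r ≠ 0`). -/
theorem smul_inter_abscissaStrip {r : ℝ} (hr : r ≠ 0) (P : Set (ℝ × ℝ)) (I : Set ℝ) :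
    r • (P ∩ {p : ℝ × ℝ | p.1 ∈ I}) = (r • P) ∩ {p : ℝ × ℝ | p.1 ∈ r • I} := by
  ext p
  rw [Set.mem_smul_set_iff_inv_smul_mem₀ hr, mem_inter_iff, mem_inter_iff,
    Set.mem_smul_set_iff_inv_smul_mem₀ hr, mem_setOf_eq, mem_setOf_eq,
    Set.mem_smul_set_iff_inv_smul_mem₀ hr]
  simp [smul_eq_mul]

/-! ### The engine, homogeneous form -/

/-- **Chimera Brunn–Minkowski with abscissa runs in every height slice, homogeneous form.**  With the
runs structure of `chimera3_sliceRuns_volume_rpow_mul_le` in Minkowski form (`Z_i ⊇ I_i + J_i`,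
`C ∋ a + w`), `a³ ≤ |A|` and `b³ ≤ |W₀|` (`a, b > 0`): `(a + b)³ ≤ |C|`. -/
theorem chimera3_sliceRuns_pow {A C W₀ : Set (Fin 3 → ℝ)} (hA : MeasurableSet A) (hC : MeasurableSet C)
    (hW₀ : MeasurableSet W₀)
    (hruns : ∀ t u : ℝ, ∃ (N : ℕ) (I J Z : Fin N → Set ℝ) (K : Fin N → Set (Fin 3 → ℝ))
        (θ : Fin N → ℝ≥0∞),
      (∀ i, MeasurableSet (I i)) ∧ (∀ i, MeasurableSet (J i)) ∧ (∀ i, MeasurableSet (Z i)) ∧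
      (∀ i, MeasurableSet (K i)) ∧ (∀ i, I i + J i ⊆ Z i) ∧
      (∀ i j, i ≠ j → Disjoint (Z i) (Z j)) ∧ (∑ i, θ i = 1) ∧
      (∀ i, θ i * volume {p : ℝ × ℝ | (![p.1, p.2, t] : Fin 3 → ℝ) ∈ A} ≤
        volume {p : ℝ × ℝ | (![p.1, p.2, t] : Fin 3 → ℝ) ∈ A ∧ p.1 ∈ I i}) ∧
      (∀ i, θ i * volume {p : ℝ × ℝ | (![p.1, p.2, u] : Fin 3 → ℝ) ∈ W₀} ≤
        volume {p : ℝ × ℝ | (![p.1, p.2, u] : Fin 3 → ℝ) ∈ K i ∧ p.1 ∈ J i}) ∧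
      (∀ i, ∀ a ∈ A, a 2 = t → a 0 ∈ I i → ∀ w ∈ K i, w 2 = u → w 0 ∈ J i → a + w ∈ C))
    {a b : ℝ} (ha : 0 < a) (hb : 0 < b) (hvA : ENNReal.ofReal (a ^ 3) ≤ volume A)
    (hvB : ENNReal.ofReal (b ^ 3) ≤ volume W₀) :
    ENNReal.ofReal ((a + b) ^ 3) ≤ volume C := by
  have hab : 0 < a + b := add_pos ha hb
  set s : ℝ := b / (a + b) with hs
  have hs0 : 0 < s := div_pos hb hab
  have hs1 : s < 1 := (div_lt_one hab).2 (by linarith)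
  have h1s : 1 - s = a / (a + b) := by rw [hs]; field_simp; ring
  have hvA' : 1 ≤ volume (a⁻¹ • A) := by
    rw [volume_smul_fin3, abs_of_pos (inv_pos.2 ha)]
    calc (1 : ℝ≥0∞) = ENNReal.ofReal (a⁻¹ ^ 3) * ENNReal.ofReal (a ^ 3) := by
          rw [← ENNReal.ofReal_mul (pow_nonneg (inv_pos.2 ha).le _), ← mul_pow,
            inv_mul_cancel₀ ha.ne', one_pow, ENNReal.ofReal_one]
      _ ≤ ENNReal.ofReal (a⁻¹ ^ 3) * volume A := by gcongr
  have hvB' : 1 ≤ volume (b⁻¹ • W₀) := by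
    rw [volume_smul_fin3, abs_of_pos (inv_pos.2 hb)]
    calc (1 : ℝ≥0∞) = ENNReal.ofReal (b⁻¹ ^ 3) * ENNReal.ofReal (b ^ 3) := by
          rw [← ENNReal.ofReal_mul (pow_nonneg (inv_pos.2 hb).le _), ← mul_pow,
            inv_mul_cancel₀ hb.ne', one_pow, ENNReal.ofReal_one]
      _ ≤ ENNReal.ofReal (b⁻¹ ^ 3) * volume W₀ := by gcongr
  -- the runs structure of the scaled data
  have hruns' : ∀ t' u' : ℝ, ∃ (N : ℕ) (I J Z : Fin N → Set ℝ) (K : Fin N → Set (Fin 3 → ℝ))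
        (θ : Fin N → ℝ≥0∞),
      (∀ i, MeasurableSet (I i)) ∧ (∀ i, MeasurableSet (J i)) ∧ (∀ i, MeasurableSet (Z i)) ∧
      (∀ i, MeasurableSet (K i)) ∧ (∀ i, (1 - s) • I i + s • J i ⊆ Z i) ∧
      (∀ i j, i ≠ j → Disjoint (Z i) (Z j)) ∧ (∑ i, θ i = 1) ∧
      (∀ i, θ i * volume {p : ℝ × ℝ | (![p.1, p.2, t'] : Fin 3 → ℝ) ∈ a⁻¹ • A} ≤
        volume {p : ℝ × ℝ | (![p.1, p.2, t'] : Fin 3 → ℝ) ∈ a⁻¹ • A ∧ p.1 ∈ I i}) ∧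
      (∀ i, θ i * volume {p : ℝ × ℝ | (![p.1, p.2, u'] : Fin 3 → ℝ) ∈ b⁻¹ • W₀} ≤
        volume {p : ℝ × ℝ | (![p.1, p.2, u'] : Fin 3 → ℝ) ∈ K i ∧ p.1 ∈ J i}) ∧
      (∀ i, ∀ x ∈ a⁻¹ • A, x 2 = t' → x 0 ∈ I i → ∀ w ∈ K i, w 2 = u' → w 0 ∈ J i →
        (1 - s) • x + s • w ∈ (a + b)⁻¹ • C) := by
    intro t' u'
    obtain ⟨N, I, J, Z, K, θ, hI, hJ, hZ, hK, hIJZ, hZdisj, hθ1, hθA, hθW, hsub⟩ :=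
      hruns (a * t') (b * u')
    refine ⟨N, fun i => a⁻¹ • I i, fun i => b⁻¹ • J i, fun i => (a + b)⁻¹ • Z i, fun i => b⁻¹ • K i, θ,
      fun i => (hI i).const_smul₀ a⁻¹, fun i => (hJ i).const_smul₀ b⁻¹, fun i => (hZ i).const_smul₀ (a + b)⁻¹,
      fun i => (hK i).const_smul₀ b⁻¹, ?_, ?_, hθ1, ?_, ?_, ?_⟩
    · intro i z hz
      obtain ⟨_, ⟨_, ⟨p, hp, rfl⟩, rfl⟩, _, ⟨_, ⟨q, hq, rfl⟩, rfl⟩, rfl⟩ := hz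
      refine Set.mem_smul_set.2 ⟨p + q, hIJZ i (Set.add_mem_add hp hq), ?_⟩
      simp only [smul_eq_mul]
      rw [h1s, hs]
      field_simp
    · intro i j hij
      rw [Set.disjoint_left]
      intro z hzi hzj
      rw [Set.mem_smul_set_iff_inv_smul_mem₀ (inv_ne_zero hab.ne')] at hzi hzj
      exact Set.disjoint_left.1 (hZdisj i j hij) hzi hzj
    · intro i
      have hsl : {p : ℝ × ℝ | (![p.1, p.2, t'] : Fin 3 → ℝ) ∈ a⁻¹ • A} =
          a⁻¹ • {p : ℝ × ℝ | (![p.1, p.2, a * t'] : Fin 3 → ℝ) ∈ A} := by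
        rw [slice3_smul (inv_ne_zero ha.ne'), inv_inv]
      have hsl' : {p : ℝ × ℝ | (![p.1, p.2, t'] : Fin 3 → ℝ) ∈ a⁻¹ • A ∧ p.1 ∈ a⁻¹ • I i} =
          a⁻¹ • {p : ℝ × ℝ | (![p.1, p.2, a * t'] : Fin 3 → ℝ) ∈ A ∧ p.1 ∈ I i} := by
        rw [Set.setOf_and, Set.setOf_and, hsl, ← smul_inter_abscissaStrip (inv_ne_zero ha.ne')]
      rw [hsl, hsl', volume_smul_real2, volume_smul_real2, mul_left_comm]
      exact mul_le_mul' le_rfl (hθA i)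
    · intro i
      have hsl : {p : ℝ × ℝ | (![p.1, p.2, u'] : Fin 3 → ℝ) ∈ b⁻¹ • W₀} =
          b⁻¹ • {p : ℝ × ℝ | (![p.1, p.2, b * u'] : Fin 3 → ℝ) ∈ W₀} := by
        rw [slice3_smul (inv_ne_zero hb.ne'), inv_inv]
      have hsl' : {p : ℝ × ℝ | (![p.1, p.2, u'] : Fin 3 → ℝ) ∈ b⁻¹ • K i ∧ p.1 ∈ b⁻¹ • J i} =
          b⁻¹ • {p : ℝ × ℝ | (![p.1, p.2, b * u'] : Fin 3 → ℝ) ∈ K i ∧ p.1 ∈ J i} := by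
        rw [Set.setOf_and, Set.setOf_and, slice3_smul (inv_ne_zero hb.ne'), inv_inv,
          ← smul_inter_abscissaStrip (inv_ne_zero hb.ne')]
      rw [hsl, hsl', volume_smul_real2, volume_smul_real2, mul_left_comm]
      exact mul_le_mul' le_rfl (hθW i)
    · intro i x hx hx2 hx0 w hw hw2 hw0
      obtain ⟨x', hx', rfl⟩ := Set.mem_smul_set.1 hx
      obtain ⟨w', hw', rfl⟩ := Set.mem_smul_set.1 hw
      have hx2' : x' 2 = a * t' := by
        have := hx2; simp only [Pi.smul_apply, smul_eq_mul] at this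
        field_simp at this; linarith [this]
      have hx0' : x' 0 ∈ I i := by
        have := (Set.mem_smul_set_iff_inv_smul_mem₀ (inv_ne_zero ha.ne') _ _).1 hx0
        simpa [smul_eq_mul, ← mul_assoc, mul_inv_cancel₀ ha.ne'] using this
      have hw2' : w' 2 = b * u' := by
        have := hw2; simp only [Pi.smul_apply, smul_eq_mul] at this
        field_simp at this; linarith [this]
      have hw0' : w' 0 ∈ J i := by
        have := (Set.mem_smul_set_iff_inv_smul_mem₀ (inv_ne_zero hb.ne') _ _).1 hw0
        simpa [smul_eq_mul, ← mul_assoc, mul_inv_cancel₀ hb.ne'] using this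
      refine Set.mem_smul_set.2 ⟨x' + w', hsub i x' hx' hx2' hx0' w' hw' hw2' hw0', ?_⟩
      rw [h1s, hs, smul_smul, smul_smul, div_mul_eq_mul_div, mul_inv_cancel₀ ha.ne',
        div_mul_eq_mul_div, mul_inv_cancel₀ hb.ne', one_div, smul_add]
  have hmult := chimera3_sliceRuns_volume_rpow_mul_le hs0 hs1 (hA.const_smul₀ a⁻¹)
    (hC.const_smul₀ (a + b)⁻¹) (hW₀.const_smul₀ b⁻¹) hruns'
  have hone : (1 : ℝ≥0∞) ≤ volume ((a + b)⁻¹ • C) := by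
    calc (1 : ℝ≥0∞) = 1 ^ (1 - s) * 1 ^ s := by rw [ENNReal.one_rpow, ENNReal.one_rpow, one_mul]
      _ ≤ volume (a⁻¹ • A) ^ (1 - s) * volume (b⁻¹ • W₀) ^ s :=
          mul_le_mul' (ENNReal.rpow_le_rpow hvA' (by linarith)) (ENNReal.rpow_le_rpow hvB' hs0.le)
      _ ≤ volume ((a + b)⁻¹ • C) := hmult
  rw [volume_smul_fin3, abs_of_pos (inv_pos.2 hab)] at hone
  calc ENNReal.ofReal ((a + b) ^ 3) = ENNReal.ofReal ((a + b) ^ 3) * 1 := (mul_one _).symm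
    _ ≤ ENNReal.ofReal ((a + b) ^ 3) * (ENNReal.ofReal ((a + b)⁻¹ ^ 3) * volume C) := by gcongr
    _ = volume C := by
        rw [← mul_assoc, ← ENNReal.ofReal_mul (pow_nonneg hab.le _), ← mul_pow,
          mul_inv_cancel₀ hab.ne', one_pow, ENNReal.ofReal_one, one_mul]

/-- **Chimera Brunn–Minkowski with abscissa runs in every height slice, root form**:
`|A|^{1/3} + |W₀|^{1/3} ≤ |C|^{1/3}` (`0 < |A|, |W₀| < ∞`) under the runs structure of
`chimera3_sliceRuns_pow`. -/
theorem chimera3_sliceRuns_brunnMinkowski {A C W₀ : Set (Fin 3 → ℝ)} (hA : MeasurableSet A)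
    (hC : MeasurableSet C) (hW₀ : MeasurableSet W₀)
    (hruns : ∀ t u : ℝ, ∃ (N : ℕ) (I J Z : Fin N → Set ℝ) (K : Fin N → Set (Fin 3 → ℝ))
        (θ : Fin N → ℝ≥0∞),
      (∀ i, MeasurableSet (I i)) ∧ (∀ i, MeasurableSet (J i)) ∧ (∀ i, MeasurableSet (Z i)) ∧
      (∀ i, MeasurableSet (K i)) ∧ (∀ i, I i + J i ⊆ Z i) ∧
      (∀ i j, i ≠ j → Disjoint (Z i) (Z j)) ∧ (∑ i, θ i = 1) ∧
      (∀ i, θ i * volume {p : ℝ × ℝ | (![p.1, p.2, t] : Fin 3 → ℝ) ∈ A} ≤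
        volume {p : ℝ × ℝ | (![p.1, p.2, t] : Fin 3 → ℝ) ∈ A ∧ p.1 ∈ I i}) ∧
      (∀ i, θ i * volume {p : ℝ × ℝ | (![p.1, p.2, u] : Fin 3 → ℝ) ∈ W₀} ≤
        volume {p : ℝ × ℝ | (![p.1, p.2, u] : Fin 3 → ℝ) ∈ K i ∧ p.1 ∈ J i}) ∧
      (∀ i, ∀ a ∈ A, a 2 = t → a 0 ∈ I i → ∀ w ∈ K i, w 2 = u → w 0 ∈ J i → a + w ∈ C))
    (hA0 : volume A ≠ 0) (hAt : volume A ≠ ⊤) (hB0 : volume W₀ ≠ 0) (hBt : volume W₀ ≠ ⊤) :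
    volume A ^ ((3 : ℕ)⁻¹ : ℝ) + volume W₀ ^ ((3 : ℕ)⁻¹ : ℝ) ≤ volume C ^ ((3 : ℕ)⁻¹ : ℝ) := by
  have hn : (3 : ℕ) ≠ 0 := by norm_num
  have hn0 : (0 : ℝ) < ((3 : ℕ)⁻¹ : ℝ) := by positivity
  set a : ℝ := (volume A).toReal ^ ((3 : ℕ)⁻¹ : ℝ) with ha_def
  set b : ℝ := (volume W₀).toReal ^ ((3 : ℕ)⁻¹ : ℝ) with hb_def
  have ha : 0 < a := Real.rpow_pos_of_pos (ENNReal.toReal_pos hA0 hAt) _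
  have hb : 0 < b := Real.rpow_pos_of_pos (ENNReal.toReal_pos hB0 hBt) _
  have han : ENNReal.ofReal (a ^ 3) = volume A := by
    rw [ha_def, Real.rpow_inv_natCast_pow ENNReal.toReal_nonneg hn, ENNReal.ofReal_toReal hAt]
  have hbn : ENNReal.ofReal (b ^ 3) = volume W₀ := by
    rw [hb_def, Real.rpow_inv_natCast_pow ENNReal.toReal_nonneg hn, ENNReal.ofReal_toReal hBt]
  have hpow := chimera3_sliceRuns_pow hA hC hW₀ hruns ha hb han.le hbn.le
  have hroot := ENNReal.rpow_le_rpow hpow hn0.le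
  rw [ENNReal.ofReal_rpow_of_nonneg (pow_nonneg (add_nonneg ha.le hb.le) _) hn0.le,
    Real.pow_rpow_inv_natCast (add_nonneg ha.le hb.le) hn, ENNReal.ofReal_add ha.le hb.le] at hroot
  have hA' : ENNReal.ofReal a = volume A ^ ((3 : ℕ)⁻¹ : ℝ) := by
    rw [ha_def, ← ENNReal.ofReal_rpow_of_nonneg ENNReal.toReal_nonneg hn0.le,
      ENNReal.ofReal_toReal hAt]
  have hB' : ENNReal.ofReal b = volume W₀ ^ ((3 : ℕ)⁻¹ : ℝ) := by
    rw [hb_def, ← ENNReal.ofReal_rpow_of_nonneg ENNReal.toReal_nonneg hn0.le,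
      ENNReal.ofReal_toReal hBt]
  rwa [hA', hB'] at hroot

end Summit.Ventures.Crystal3D.Theorems.Chimera

end
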